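import Summits.CriticalPhenomena.Ising3DConformalLimit.Theorems.EnergyNotSigmaSquaredMoebiusLimitExistsDefs
import Mathlib.Geometry.Euclidean.Inversion.Basic
import Literature.Probability.LatticeModels.TreeGraphWickPairInteraction
import Literature.Probability.LatticeModels.GaussianPairingBound
import HarnessLib

/-!
# The Wick family of a pure power is Möbius covariant
(line `only-interaction-breaks-moebius` of the crux `MoebiusLimitExists`, item stmt-CriticalPhenomena-1344;
stub `stub_wickPowerMoebius`)

`wickPower Δ` is the normalised Wick (generalised-free, mean-field) family of the pure power
`K_Δ(p, q) = ‖p − q‖^{-2Δ}` on `ℝ³`: at even order `2m` on non-coincident configurations the Gaussian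
pairing functional `𝒢_m[K_Δ](x) = (2^m m!)⁻¹ Σ_τ ∏_{j<m} K_Δ(x_{τ(2j)}, x_{τ(2j+1)})` (`pairingSum`),
zero elsewhere. We prove that it is Möbius covariant with scaling dimension `Δ` for EVERY real `Δ`
(`stub_wickPowerMoebius`): invariant under translations and all of `O(3)`, covariant under dilations
`x ↦ c x` with the factor `c^{-nΔ}` and under the unit inversion `ι x = x/‖x‖²` with the factor
`∏ᵢ ‖xᵢ‖^{2Δ}` off the origin (Di Francesco–Mathieu–Sénéchal 1997, §4.3.1, eq. (4.62) for the
generalised free field).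

Mechanism. All four generators act on configurations through an injective map `f` of `ℝ³`, so they
preserve (non-)coincidence (`comp_mem_nonCoincident_iff`) and both sides vanish off `NonCoincident`
and at odd orders. At even order everything reduces to the behaviour of the KERNEL along `f` at the
distinct points of the configuration: `K_Δ(f p, f q) = r · g(p) g(q) · K_Δ(p, q)` with a constant `r`
and a gauge `g` (`r = 1, g = 1` for isometries; `r = c^{-2Δ}, g = 1` for dilations;
`r = 1, g = ‖·‖^{2Δ}` for the inversion, from `‖ι p − ι q‖ = ‖p − q‖/(‖p‖‖q‖)`,
`EuclideanGeometry.dist_inversion_inversion`). A pairing uses `m` pairs of distinct indices covering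
every index exactly once, whence `𝒢_m[K_Δ](f ∘ x) = r^m (∏ᵢ g(xᵢ)) 𝒢_m[K_Δ](x)`: the constant is
`PairIsing.pairingSum_eq_pow_mul`, the gauge is the GAUGE IDENTITY `pairingSum_gauge`
(`𝒢_m[g ⊗ g · K](x) = (∏ᵢ g(xᵢ)) 𝒢_m[K](x)`, reindexing `∏_{j<m} g(x_{τ(2j)}) g(x_{τ(2j+1)})` along
the bijection `(j, k) ↦ τ(2j+k)`). The common shape is `wickPower_comp_eq`.

References: P. Di Francesco, P. Mathieu, D. Sénéchal, *Conformal Field Theory* (Springer 1997),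
§4.1 eq. (4.15) and §4.3.1 eq. (4.62) [FrancescoMathieuSenechal1997].
-/

noncomputable section

open Filter Topology Set Function
open Literature.Probability.LatticeModels
open EuclideanGeometry Finset

namespace Summit.CriticalPhenomena.Ising3DConformalLimit.MoebiusLimitExistsOnlyInteraction

namespace WickPowerMoebius

/-! ### The gauge identity for the pairing functional -/

/-- Along an ordering `τ` of `2m` points, the pairs `(x_{τ(2j)}, x_{τ(2j+1)})`, `j < m`, use every
point exactly once: `∏_{j<m} g(x_{τ(2j)}) g(x_{τ(2j+1)}) = ∏ᵢ g(xᵢ)`. [folklore] -/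
theorem prod_pair_eq_prod {α : Type*} (g : α → ℝ) (m : ℕ) (x : Fin (2 * m) → α)
    (τ : Equiv.Perm (Fin (2 * m))) :
    ∏ j : Fin m, g (x (τ (pairIdx m (j, 0)))) * g (x (τ (pairIdx m (j, 1)))) = ∏ i, g (x i) := by
  rw [← Fintype.prod_equiv ((pairIdx m).trans τ) (fun jk => g (x (τ (pairIdx m jk))))
    (fun i => g (x i)) (fun _ => rfl), Fintype.prod_prod_type]
  simp only [Fin.prod_univ_two]

/-- **Gauge identity.** Multiplying a kernel by a gauge `g ⊗ g` multiplies its pairing functional by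
`∏ᵢ g(xᵢ)`: `𝒢_m[(p, q) ↦ g(p) g(q) K(p, q)](x) = (∏ᵢ g(xᵢ)) · 𝒢_m[K](x)` (every pairing covers each
index exactly once). [folklore] -/
theorem pairingSum_gauge {α : Type*} (K : α → α → ℝ) (g : α → ℝ) (m : ℕ) (x : Fin (2 * m) → α) :
    pairingSum (fun p q => g p * g q * K p q) m x = (∏ i, g (x i)) * pairingSum K m x := by
  simp only [pairingSum]
  have hτ : ∀ τ : Equiv.Perm (Fin (2 * m)),
      ∏ j : Fin m, g (x (τ (pairIdx m (j, 0)))) * g (x (τ (pairIdx m (j, 1)))) *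
          K (x (τ (pairIdx m (j, 0)))) (x (τ (pairIdx m (j, 1)))) =
        (∏ i, g (x i)) * ∏ j : Fin m, K (x (τ (pairIdx m (j, 0)))) (x (τ (pairIdx m (j, 1)))) := by
    intro τ
    rw [Finset.prod_mul_distrib, prod_pair_eq_prod]
  rw [Finset.sum_congr rfl fun τ _ => hτ τ, ← Finset.mul_sum]
  ring

/-! ### The power kernel along the Möbius generators -/

/-- Translation invariance of the kernel: `K_Δ(p + v, q + v) = K_Δ(p, q)`. [folklore] -/
theorem powerKernel_add (Δ : ℝ) (p q v : EuclideanSpace ℝ (Fin 3)) :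
    powerKernel Δ (p + v) (q + v) = powerKernel Δ p q := by
  simp [powerKernel, add_sub_add_right_eq_sub]

/-- `O(3)`-invariance of the kernel: `K_Δ(R p, R q) = K_Δ(p, q)` for a linear isometry `R`.
[folklore] -/
theorem powerKernel_map (Δ : ℝ) (R : EuclideanSpace ℝ (Fin 3) ≃ₗᵢ[ℝ] EuclideanSpace ℝ (Fin 3))
    (p q : EuclideanSpace ℝ (Fin 3)) : powerKernel Δ (R p) (R q) = powerKernel Δ p q := by
  simp only [powerKernel, ← map_sub, LinearIsometryEquiv.norm_map]

/-- Scale covariance of the kernel: `K_Δ(c p, c q) = c^{-2Δ} K_Δ(p, q)` for `c > 0`. [folklore] -/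
theorem powerKernel_smul (Δ : ℝ) {c : ℝ} (hc : 0 < c) (p q : EuclideanSpace ℝ (Fin 3)) :
    powerKernel Δ (c • p) (c • q) = c ^ (-(2 * Δ)) * powerKernel Δ p q := by
  simp only [powerKernel, ← smul_sub, norm_smul, Real.norm_eq_abs, abs_of_pos hc]
  exact Real.mul_rpow hc.le (norm_nonneg _)

/-- The kernel under the unit inversion `ι`: `‖ι p − ι q‖ = ‖p − q‖/(‖p‖‖q‖)`
(`EuclideanGeometry.dist_inversion_inversion`), so `K_Δ(ι p, ι q) = ‖p‖^{2Δ} ‖q‖^{2Δ} K_Δ(p, q)` for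
`p, q ≠ 0`. [folklore] -/
theorem powerKernel_inversion (Δ : ℝ) {p q : EuclideanSpace ℝ (Fin 3)} (hp : p ≠ 0) (hq : q ≠ 0) :
    powerKernel Δ (inversion 0 1 p) (inversion 0 1 q) =
      ‖p‖ ^ (2 * Δ) * ‖q‖ ^ (2 * Δ) * powerKernel Δ p q := by
  simp only [powerKernel]
  rw [← dist_eq_norm (inversion 0 1 p), dist_inversion_inversion hp hq, one_pow, dist_zero_right,
    dist_zero_right, dist_eq_norm]
  have hpq : 0 ≤ ‖p‖ * ‖q‖ := by positivity
  rw [Real.mul_rpow (by positivity) (norm_nonneg _), one_div, Real.inv_rpow hpq, Real.rpow_neg hpq,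
    inv_inv, Real.mul_rpow (norm_nonneg _) (norm_nonneg _)]

/-! ### Transport of the Wick family along an injective map -/

/-- Composition with an injective map of `ℝ³` preserves (non-)coincidence. [folklore] -/
theorem comp_mem_nonCoincident_iff {n : ℕ}
    {f : EuclideanSpace ℝ (Fin 3) → EuclideanSpace ℝ (Fin 3)} (hf : Injective f)
    (x : Fin n → EuclideanSpace ℝ (Fin 3)) :
    (fun i => f (x i)) ∈ NonCoincident 3 n ↔ x ∈ NonCoincident 3 n := by
  rw [mem_nonCoincident, mem_nonCoincident]
  exact hf.of_comp_iff x

/-- **Common shape of the four covariance clauses.** If `f` is injective and the kernel transforms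
along `f` at the distinct points of the configuration `x` as `K_Δ(f xᵢ, f xⱼ) = r g(xᵢ) g(xⱼ) K_Δ(xᵢ, xⱼ)`,
then `W_Δ(f ∘ x) = w · W_Δ(x)` for any weight `w` equal to `r^m ∏ᵢ g(xᵢ)` whenever the order is
`n = 2m` (both sides vanish off `NonCoincident` and at odd orders). [folklore] -/
theorem wickPower_comp_eq {Δ : ℝ} {n : ℕ} {f : EuclideanSpace ℝ (Fin 3) → EuclideanSpace ℝ (Fin 3)}
    (hf : Injective f) (x : Fin n → EuclideanSpace ℝ (Fin 3)) (r : ℝ)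
    (g : EuclideanSpace ℝ (Fin 3) → ℝ) (w : ℝ)
    (hK : ∀ i j, i ≠ j →
      powerKernel Δ (f (x i)) (f (x j)) = r * (g (x i) * g (x j) * powerKernel Δ (x i) (x j)))
    (hw : ∀ m, n = 2 * m → w = r ^ m * ∏ i, g (x i)) :
    wickPower Δ n (fun i => f (x i)) = w * wickPower Δ n x := by
  by_cases hx : x ∈ NonCoincident 3 n
  · obtain ⟨m, rfl | rfl⟩ := Nat.even_or_odd' n
    · rw [wickPower_of_mem_even ((comp_mem_nonCoincident_iff hf x).2 hx), wickPower_of_mem_even hx,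
        hw m rfl, PairIsing.pairingSum_eq_pow_mul (fun p q => g p * g q * powerKernel Δ p q)
          (powerKernel Δ) r m x (fun i => f (x i)) hK, pairingSum_gauge, mul_assoc]
    · rw [wickPower_of_odd ⟨m, rfl⟩, wickPower_of_odd ⟨m, rfl⟩, mul_zero]
  · rw [wickPower_of_not_mem hx, wickPower_of_not_mem (mt (comp_mem_nonCoincident_iff hf x).1 hx),
      mul_zero]

/-! ### The four clauses -/

/-- `W_Δ` is translation invariant. [folklore] -/
theorem isTranslationInvariant_wickPower (Δ : ℝ) : IsTranslationInvariant (wickPower Δ) := by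
  intro n v x
  refine (wickPower_comp_eq (add_left_injective v) x 1 (fun _ => 1) 1 (fun i j _ => ?_)
    (fun m _ => by simp)).trans (one_mul _)
  rw [powerKernel_add]; ring

/-- `W_Δ` is `O(3)` invariant. [folklore] -/
theorem isRotationInvariant_wickPower (Δ : ℝ) : IsRotationInvariant (wickPower Δ) := by
  intro n R x
  refine (wickPower_comp_eq R.injective x 1 (fun _ => 1) 1 (fun i j _ => ?_)
    (fun m _ => by simp)).trans (one_mul _)
  rw [powerKernel_map]; ring

/-- `W_Δ` is scale covariant with dimension `Δ`: the factor is `(c^{-2Δ})^m = c^{-(2m)Δ}`. [folklore] -/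
theorem isScaleCovariant_wickPower (Δ : ℝ) : IsScaleCovariant Δ (wickPower Δ) := by
  intro n c hc x
  refine wickPower_comp_eq (smul_right_injective _ hc.ne') x (c ^ (-(2 * Δ))) (fun _ => 1) _
    (fun i j _ => ?_) (fun m hm => ?_)
  · rw [powerKernel_smul Δ hc]; ring
  · subst hm
    simp only [Finset.prod_const_one, mul_one]
    rw [← Real.rpow_natCast, ← Real.rpow_mul hc.le]
    congr 1
    push_cast
    ring

/-- `W_Δ` is inversion covariant with dimension `Δ`: the factor is the gauge `∏ᵢ ‖xᵢ‖^{2Δ}`. [folklore] -/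
theorem isInversionCovariant_wickPower (Δ : ℝ) : IsInversionCovariant Δ (wickPower Δ) := by
  intro n x hx0
  refine wickPower_comp_eq (inversion_injective _ one_ne_zero) x 1 (fun p => ‖p‖ ^ (2 * Δ)) _
    (fun i j _ => ?_) (fun m _ => by rw [one_pow, one_mul])
  rw [one_mul]
  exact powerKernel_inversion Δ (hx0 i) (hx0 j)

end WickPowerMoebius

open WickPowerMoebius in
/-- **The Wick family of the pure power `‖p − q‖^{-2Δ}` on `ℝ³` is Möbius covariant with scaling
dimension `Δ`, for every real `Δ`** (the generalised free field of dimension `Δ`;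
Di Francesco–Mathieu–Sénéchal 1997, §4.3.1, eq. (4.62)). [folklore] -/
theorem stub_wickPowerMoebius : ∀ Δ : ℝ, IsMoebiusCovariant Δ (wickPower Δ) := by
  intro Δ
  exact ⟨⟨isTranslationInvariant_wickPower Δ, isRotationInvariant_wickPower Δ⟩,
    isScaleCovariant_wickPower Δ, isInversionCovariant_wickPower Δ⟩

end Summit.CriticalPhenomena.Ising3DConformalLimit.MoebiusLimitExistsOnlyInteraction

end
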